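import Literature.NumberTheory.EllipticCurves.WeierstrassRationalPlaces
import Literature.NumberTheory.EllipticCurves.IsogenyRamification
import Literature.NumberTheory.DiophantineGeometry.FunctionFieldDivisorClasses
import Literature.NumberTheory.DiophantineGeometry.FunctionFieldDivisorsAdicProofs
import Mathlib.Algebra.Group.AddChar
import HarnessLib

/-!
# The divisor classes of the function field of an elliptic curve are its rational points:
`Cl⁰(k(V)) ≅ Cl(k[V]) ≅ V(k)` over an arbitrary field (Stichtenoth Prop. 6.1.6–6.1.7)

Topic `NumberTheory/EllipticCurves`. Let `V` be an elliptic curve over an ARBITRARY field `k`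
(`V : WeierstrassCurve.Affine k`, `[V.IsElliptic]`), with coordinate ring `k[V]` (a Dedekind
domain), function field `k(V)`, places `PlaceOver k k(V)` (the tree's
`WeierstrassFunctionFieldPlaces.placeEquiv : {∞} ⊔ MaxSpec k[V] ≃ places`) and rational places
`placeOfPoint : V(k) ≃ {v // deg v = 1}` (`WeierstrassRationalPlaces`). Mathlib proves the group
law on `V(k)` through the injective homomorphism
`toClass : V(k) →+ Cl(k[V])`, `P ↦ [𝔪_P]` (`WeierstrassCurve.Affine.Point.toClass`). This file
proves that `toClass` is also SURJECTIVE, i.e. an isomorphism `V(k) ≅ Cl(k[V])`, and derives the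
divisor-theoretic form: the Abel–Jacobi map of `k(V)/k`.

* `finIdeal D = ∏_𝔭 𝔭^{D(P_𝔭)}` — the finite part of a divisor `D` as a fractional ideal of
  `k[V]`; `count_finIdeal`, `finIdeal_add`, `finIdeal_principalDivisor : finIdeal (x) = (x)`,
  `finIdeal_single_placeOfPoint`; its class `finClass : Div(k(V)) →+ Cl(k[V])`, killing
  principal divisors and `∞`, with `finClass (placeOfPoint P) = toClass P`.
* **`exists_principalDivisor_eq`** (Riemann–Roch, **Stichtenoth Prop. 6.1.6 (a)**): every place
  `v` of degree `d` satisfies `v ∼ P + (d - 1)·∞` for a rational place `P = placeOfPoint P`: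
  `ℓ(v - (d-1)∞) ≥ deg = 1` (the tree's `WeierstrassGenus.degree_le_ell`, i.e. `g = 1`), and a
  positive divisor of degree one is a rational place.
* **`toClass_surjective`**, `toClassEquiv : V(k) ≃+ Cl(k[V])` — every ideal class of `k[V]`
  is the class of `𝔪_P` for a unique `P ∈ V(k)` (with `[𝔪_O] := 1`).
* **`pointOfDivisor : Div(k(V)) →+ V(k)`** — the Abel–Jacobi map `D ↦ ⊕ D(v) · pt(v)`,
  characterised by `toClass (pointOfDivisor D) = finClass D`; `pointOfDivisor (placeOfPoint P) = P`,
  `pointOfDivisor (x) = O`, `pointOfDivisor ∞ = O`.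
* **`isPrincipal_iff`** (Abel–Jacobi over `k`; **Stichtenoth Prop. 6.1.7 (c)–(d)**, Silverman
  *AEC* Cor. III.3.5 over `k̄`): `D` is principal iff `deg D = 0` and `pointOfDivisor D = O`;
  `isLinearlyEquivalent_single_sub` (**Prop. 6.1.6 (a)/(b)**: a divisor of degree `0` is
  `∼ P - ∞` for the unique `P = pointOfDivisor D`), and the group isomorphism
  **`degreeZeroClassEquiv : Cl⁰(k(V)) ≃+ V(k)`** (**Prop. 6.1.7 (d)**, for the tree's divisor class
  group `AlgFunctionField.DivisorClass`), under which Stichtenoth's transported group law `⊕`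
  ((6.14)) is Mathlib's chord–tangent law.
* `divisorChar ω := ω ∘ pointOfDivisor` — a character `ω` of the finite (or any) group `V(k)`
  as an UNRAMIFIED character of the divisor group (trivial on all principal divisors), with
  `divisorChar ω (placeOfPoint P) = ω P`; the form in which the characters `ω ∈ Hom(E(𝔽_q), ℂ*)`
  of [KohelShparlinski2000] enter the ray class `L`-series of `FunctionFieldRayClassLSeries`.

Everything is proved; the definitions are real (`finIdeal`, `finClass`, `toClassEquiv`,
`pointOfDivisor`, `degreeZeroClassEquiv`, `divisorChar`); no named facts.

## Proof notes

Stichtenoth proves 6.1.6 (a) by Riemann–Roch and uniqueness by `[F : K(x)] = deg (x)_∞`; here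
existence is the same Riemann–Roch argument (`degree_le_ell`, valid over any `k`), while
uniqueness and the identification of `⊕` with the chord–tangent law come for free from Mathlib's
injective `toClass` once divisors are read as fractional ideals away from `∞`
(`finIdeal`, Mathlib's `FractionalIdeal.count` and `finprod_heightOneSpectrum_factorization'`).

## References

* H. Stichtenoth, *Algebraic Function Fields and Codes*, 2nd ed., GTM 254, Springer 2009,
  Prop. 6.1.6, (6.13)–(6.14), Prop. 6.1.7 (held copy pp. 186–187). [Stichtenoth2009]
* J. H. Silverman, *The Arithmetic of Elliptic Curves*, 2nd ed., GTM 106, Prop. III.3.4,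
  Cor. III.3.5. [SilvermanAEC2009]
* D. R. Kohel, I. E. Shparlinski, *On exponential sums and group generators for elliptic curves
  over finite fields*, ANTS-IV, LNCS 1838 (2000), §2 (the characters `ω`). [KohelShparlinski2000]
-/

noncomputable section

open scoped Classical nonZeroDivisors
open IsDedekindDomain FractionalIdeal WithZero

namespace Literature.NumberTheory.EllipticCurves.WeierstrassDivisorClassPoints

open Literature.NumberTheory.DiophantineGeometry
open AlgFunctionField WeierstrassPlaceAtInfinity WeierstrassFunctionField WeierstrassRationalPlaces

universe u

/-! ### Two lemmas on fractional ideals of a Dedekind domain -/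

section Dedekind

variable {R : Type*} [CommRing R] [IsDedekindDomain R] {L : Type*} [Field L] [Algebra R L]
  [IsFractionRing R L]

/-- The multiplicity of `𝔭` in the principal fractional ideal `(z)` is `-log` of the `𝔭`-adic
valuation of `z`. [folklore] -/
theorem count_spanSingleton_eq_neg_log (v : HeightOneSpectrum R) {z : L} (hz : z ≠ 0) :
    count L v (spanSingleton R⁰ z) = -log (v.valuation L z) := by
  obtain ⟨n, d, hd, hnd⟩ := IsFractionRing.div_surjective (A := R) z
  have hd' : (d : R) ≠ 0 := nonZeroDivisors.ne_zero hd
  have hn : n ≠ 0 := by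
    rintro rfl
    rw [map_zero, zero_div] at hnd
    exact hz hnd.symm
  have hI : spanSingleton R⁰ z =
      spanSingleton R⁰ ((algebraMap R L) d)⁻¹ * ↑(Ideal.span {n} : Ideal R) := by
    rw [coeIdeal_span_singleton, spanSingleton_mul_spanSingleton, ← hnd, div_eq_inv_mul]
  rw [count_well_defined L v ((spanSingleton_eq_zero_iff).not.mpr hz) hI, ← hnd, map_div₀,
    HeightOneSpectrum.valuation_of_algebraMap, HeightOneSpectrum.valuation_of_algebraMap,
    HeightOneSpectrum.intValuation_if_neg _ hn, HeightOneSpectrum.intValuation_if_neg _ hd',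
    ← exp_sub, log_exp]
  ring

/-- Two nonzero fractional ideals with the same multiplicities at all height-one primes are equal
(unique factorisation). [folklore] -/
theorem eq_of_forall_count_eq {I J : FractionalIdeal R⁰ L} (hI : I ≠ 0) (hJ : J ≠ 0)
    (h : ∀ v : HeightOneSpectrum R, count L v I = count L v J) : I = J := by
  rw [← finprod_heightOneSpectrum_factorization' L hI,
    ← finprod_heightOneSpectrum_factorization' L hJ]
  exact finprod_congr fun v => by rw [h v]

end Dedekind

variable {k : Type u} [Field k] (V : WeierstrassCurve.Affine k) [V.IsElliptic]

/-! ### The finite part of a divisor as a fractional ideal of `k[V]` -/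

/-- The exponents of a divisor at the finite places, as a finitely supported function on
`MaxSpec k[V]` (pull-back along the injection `𝔭 ↦ P_𝔭`). [folklore] -/
def finExps : Divisor k V.FunctionField →+ (HeightOneSpectrum V.CoordinateRing →₀ ℤ) :=
  Finsupp.comapDomain.addMonoidHom
    (PlaceOver.ofPrime_injective (K := k) (F := V.FunctionField) (R := V.CoordinateRing))

variable {V}

/-- `finExps D 𝔭 = D(P_𝔭)`. [folklore] -/
@[simp]
theorem finExps_apply (D : Divisor k V.FunctionField) (𝔭 : HeightOneSpectrum V.CoordinateRing) :
    finExps V D 𝔭 = D (PlaceOver.ofPrime k V.FunctionField 𝔭) :=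
  rfl

/-- `finExps` of a finite place. [folklore] -/
theorem finExps_single_ofPrime (𝔭 : HeightOneSpectrum V.CoordinateRing) (n : ℤ) :
    finExps V (Finsupp.single (PlaceOver.ofPrime k V.FunctionField 𝔭) n) = Finsupp.single 𝔭 n := by
  ext 𝔮
  rw [finExps_apply]
  by_cases h : 𝔮 = 𝔭
  · subst h; simp
  · rw [Finsupp.single_eq_of_ne fun e => h (PlaceOver.ofPrime_injective e),
      Finsupp.single_eq_of_ne h]

/-- `finExps` of the place at infinity vanishes. [folklore] -/
theorem finExps_single_infPlace (n : ℤ) :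
    finExps V (Finsupp.single (infPlace V) n) = 0 := by
  ext 𝔮
  rw [finExps_apply, Finsupp.single_eq_of_ne (WeierstrassPlaces.infPlace_ne_ofPrime V 𝔮).symm]
  rfl

variable (V) in
/-- **The finite part of a divisor** as a fractional ideal of the Dedekind domain `k[V]`:
`finIdeal D = ∏_𝔭 𝔭^{D(P_𝔭)}` (the place at infinity is dropped). [folklore] -/
def finIdeal (D : Divisor k V.FunctionField) :
    FractionalIdeal V.CoordinateRing⁰ V.FunctionField :=
  (finExps V D).prod fun 𝔭 n =>
    (𝔭.asIdeal : FractionalIdeal V.CoordinateRing⁰ V.FunctionField) ^ n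

/-- The multiplicity of `𝔭` in `finIdeal D` is `D(P_𝔭)`. [folklore] -/
@[simp]
theorem count_finIdeal (D : Divisor k V.FunctionField) (𝔭 : HeightOneSpectrum V.CoordinateRing) :
    count V.FunctionField 𝔭 (finIdeal V D) = D (PlaceOver.ofPrime k V.FunctionField 𝔭) := by
  rw [finIdeal, count_finsuppProd, finExps_apply]

/-- `finIdeal D ≠ 0`. [folklore] -/
theorem finIdeal_ne_zero (D : Divisor k V.FunctionField) : finIdeal V D ≠ 0 := by
  rw [finIdeal, Finsupp.prod]
  exact Finset.prod_ne_zero_iff.mpr fun 𝔭 _ => zpow_ne_zero _ (coeIdeal_ne_zero.mpr 𝔭.ne_bot)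

/-- `finIdeal 0 = 1`. [folklore] -/
@[simp]
theorem finIdeal_zero : finIdeal V (0 : Divisor k V.FunctionField) = 1 := by
  rw [finIdeal, map_zero, Finsupp.prod_zero_index]

/-- `finIdeal (D + D') = finIdeal D · finIdeal D'`. [folklore] -/
theorem finIdeal_add (D D' : Divisor k V.FunctionField) :
    finIdeal V (D + D') = finIdeal V D * finIdeal V D' := by
  refine eq_of_forall_count_eq (finIdeal_ne_zero _)
    (mul_ne_zero (finIdeal_ne_zero _) (finIdeal_ne_zero _)) fun 𝔭 => ?_
  rw [count_mul _ _ (finIdeal_ne_zero _) (finIdeal_ne_zero _), count_finIdeal, count_finIdeal,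
    count_finIdeal, Finsupp.add_apply]

/-- `finIdeal (-D) = (finIdeal D)⁻¹`. [folklore] -/
theorem finIdeal_neg (D : Divisor k V.FunctionField) : finIdeal V (-D) = (finIdeal V D)⁻¹ := by
  refine eq_of_forall_count_eq (finIdeal_ne_zero _) (inv_ne_zero (finIdeal_ne_zero _)) fun 𝔭 => ?_
  rw [count_inv, count_finIdeal, count_finIdeal, Finsupp.neg_apply]

/-- `finIdeal (D - D') = finIdeal D / finIdeal D'`. [folklore] -/
theorem finIdeal_sub (D D' : Divisor k V.FunctionField) :
    finIdeal V (D - D') = finIdeal V D * (finIdeal V D')⁻¹ := by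
  rw [sub_eq_add_neg, finIdeal_add, finIdeal_neg]

/-- The finite part of `n · P_𝔭` is `𝔭ⁿ`. [folklore] -/
theorem finIdeal_single_ofPrime (𝔭 : HeightOneSpectrum V.CoordinateRing) (n : ℤ) :
    finIdeal V (Finsupp.single (PlaceOver.ofPrime k V.FunctionField 𝔭) n) =
      (𝔭.asIdeal : FractionalIdeal V.CoordinateRing⁰ V.FunctionField) ^ n := by
  rw [finIdeal, finExps_single_ofPrime, Finsupp.prod_single_index]
  exact zpow_zero _

/-- The finite part of `n · ∞` is trivial. [folklore] -/
@[simp]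
theorem finIdeal_single_infPlace (n : ℤ) :
    finIdeal V (Finsupp.single (infPlace V) n) = 1 := by
  rw [finIdeal, finExps_single_infPlace, Finsupp.prod_zero_index]

/-- The finite part of the place of an affine point `(a, b)` is its maximal ideal `(x - a, y - b)`.
[folklore] -/
theorem finIdeal_single_placeOfPoint_some {a b : k} (h : V.Nonsingular a b) :
    finIdeal V (Finsupp.single (placeOfPoint V (.some a b h)) 1) =
      (pointIdeal V a b : FractionalIdeal V.CoordinateRing⁰ V.FunctionField) := by
  rw [placeOfPoint_some, finIdeal_single_ofPrime, zpow_one, pointPrime_asIdeal]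

/-- **`ord` at a finite place is the multiplicity in the principal fractional ideal.**
[folklore] -/
theorem ord_ofPrime_eq_count (𝔭 : HeightOneSpectrum V.CoordinateRing) {x : V.FunctionField}
    (hx : x ≠ 0) :
    (PlaceOver.ofPrime k V.FunctionField 𝔭).ord x =
      count V.FunctionField 𝔭 (spanSingleton V.CoordinateRing⁰ x) := by
  rw [PlaceOver.ord_ofPrime_eq_neg_log 𝔭 hx, count_spanSingleton_eq_neg_log 𝔭 hx]

/-- **The finite part of a principal divisor `(x)` is the principal fractional ideal `(x)`.**
[folklore] -/
theorem finIdeal_principalDivisor {x : V.FunctionField} (hx : x ≠ 0) :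
    finIdeal V (principalDivisor k x) = spanSingleton V.CoordinateRing⁰ x := by
  refine eq_of_forall_count_eq (finIdeal_ne_zero _) ((spanSingleton_eq_zero_iff).not.mpr hx)
    fun 𝔭 => ?_
  rw [count_finIdeal, principalDivisor_apply (finite_setOf_ord_ne_zero_holds hx),
    ord_ofPrime_eq_count 𝔭 hx]

/-! ### The class of the finite part in `Cl(k[V])` -/

variable (V) in
/-- The finite part of a divisor as a unit fractional ideal. [folklore] -/
def finUnit (D : Divisor k V.FunctionField) :
    (FractionalIdeal V.CoordinateRing⁰ V.FunctionField)ˣ :=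
  Units.mk0 (finIdeal V D) (finIdeal_ne_zero D)

/-- Coercion of `finUnit`. [folklore] -/
@[simp]
theorem coe_finUnit (D : Divisor k V.FunctionField) :
    (finUnit V D : FractionalIdeal V.CoordinateRing⁰ V.FunctionField) = finIdeal V D :=
  rfl

variable (V) in
/-- **The ideal class of the finite part of a divisor**, `Div(k(V)) →+ Cl(k[V])`,
`D ↦ [∏_𝔭 𝔭^{D(P_𝔭)}]`. [folklore] -/
def finClass : Divisor k V.FunctionField →+ Additive (ClassGroup V.CoordinateRing) where
  toFun D := Additive.ofMul (ClassGroup.mk V.FunctionField (finUnit V D))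
  map_zero' := by
    have h1 : finUnit V (0 : Divisor k V.FunctionField) = 1 := Units.ext (by simp)
    rw [h1, map_one]
    rfl
  map_add' D D' := by
    have hm : finUnit V (D + D') = finUnit V D * finUnit V D' :=
      Units.ext (by simp [finIdeal_add])
    rw [hm, map_mul]
    rfl

/-- Unfolding of `finClass`. [folklore] -/
theorem finClass_apply (D : Divisor k V.FunctionField) :
    finClass V D = Additive.ofMul (ClassGroup.mk V.FunctionField (finUnit V D)) :=
  rfl

/-- `finClass D` depends only on the fractional ideal `finIdeal D`. [folklore] -/
theorem finClass_eq_of_finIdeal_eq {D : Divisor k V.FunctionField}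
    {I : (FractionalIdeal V.CoordinateRing⁰ V.FunctionField)ˣ}
    (h : finIdeal V D = I) : finClass V D = Additive.ofMul (ClassGroup.mk V.FunctionField I) := by
  rw [finClass_apply]
  congr 2
  exact Units.ext (by simpa using h)

/-- **Principal divisors have trivial class.** [folklore] -/
theorem finClass_principalDivisor (x : V.FunctionField) :
    finClass V (principalDivisor k x) = 0 := by
  rcases eq_or_ne x 0 with rfl | hx
  · have h0 : principalDivisor k (0 : V.FunctionField) = 0 := by
      -- `(0)` has the junk value `0`: `ord_v 0 = 0` for every place `v`
      have hord : ∀ v : PlaceOver k V.FunctionField, v.ord (0 : V.FunctionField) = 0 := fun v => by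
        rw [PlaceOver.ord, dif_pos v.toValuationSubring.zero_mem]
        have h0 : (⟨(0 : V.FunctionField), v.toValuationSubring.zero_mem⟩ : v.toValuationSubring) = 0 :=
          rfl
        rw [h0, IsDiscreteValuationRing.addVal_zero, ENat.toNat_top, Nat.cast_zero]
      have hfin : {v : PlaceOver k V.FunctionField | v.ord (0 : V.FunctionField) ≠ 0}.Finite := by
        convert Set.finite_empty
        ext v
        simp [hord v]
      ext v
      rw [principalDivisor_apply hfin, hord]
      rfl
    rw [h0, map_zero]
  · rw [finClass_apply]
    have hp : ClassGroup.mk V.FunctionField (finUnit V (principalDivisor k x)) = 1 := by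
      rw [ClassGroup.mk_eq_one_iff, coe_finUnit, finIdeal_principalDivisor hx, coe_spanSingleton]
      exact ⟨x, rfl⟩
    rw [hp]
    rfl

/-- The place at infinity has trivial class. [folklore] -/
@[simp]
theorem finClass_single_infPlace (n : ℤ) :
    finClass V (Finsupp.single (infPlace V) n) = 0 := by
  rw [finClass_apply]
  have h1 : finUnit V (Finsupp.single (infPlace V) n) = 1 := Units.ext (by simp)
  rw [h1, map_one]
  rfl

/-- **The class of the place of a rational point is `toClass P`** (for `P = O` both are `0`).
[folklore] -/
theorem finClass_single_placeOfPoint (P : V.Point) :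
    finClass V (Finsupp.single (placeOfPoint V P) 1) = WeierstrassCurve.Affine.Point.toClass P := by
  rcases P with _ | ⟨a, b, h⟩
  · exact finClass_single_infPlace 1
  · rw [WeierstrassCurve.Affine.Point.toClass_some]
    exact finClass_eq_of_finIdeal_eq (finIdeal_single_placeOfPoint_some h)

/-- `finClass (n · placeOfPoint P) = n · toClass P`. [folklore] -/
theorem finClass_single_placeOfPoint_zsmul (P : V.Point) (n : ℤ) :
    finClass V (Finsupp.single (placeOfPoint V P) n) =
      n • WeierstrassCurve.Affine.Point.toClass P := by
  rw [← finClass_single_placeOfPoint, ← map_zsmul, Finsupp.smul_single, smul_eq_mul, mul_one]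

/-- The class of a finite place `P_𝔭` is `[𝔭]`. [folklore] -/
theorem finClass_single_ofPrime (𝔭 : HeightOneSpectrum V.CoordinateRing) :
    finClass V (Finsupp.single (PlaceOver.ofPrime k V.FunctionField 𝔭) 1) =
      Additive.ofMul (ClassGroup.mk0 ⟨𝔭.asIdeal, mem_nonZeroDivisors_of_ne_zero 𝔭.ne_bot⟩) := by
  rw [← ClassGroup.mk_mk0 V.FunctionField]
  refine finClass_eq_of_finIdeal_eq ?_
  rw [finIdeal_single_ofPrime, zpow_one, FractionalIdeal.coe_mk0]

/-! ### Riemann–Roch: every place is a rational place plus a multiple of `∞`, up to `∼`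
(Stichtenoth Prop. 6.1.6 (a)) -/

omit [V.IsElliptic] in
/-- A positive divisor of degree one is a single rational place. [folklore] -/
theorem exists_eq_single_of_degree_eq_one {E : Divisor k V.FunctionField} (hE : 0 ≤ E)
    (h1 : E.degree = 1) : ∃ w : PlaceOver k V.FunctionField, w.degree = 1 ∧ E = Finsupp.single w 1 := by
  -- some place `w` lies in the support
  have hE0 : E ≠ 0 := by rintro rfl; simp at h1
  obtain ⟨w, hw⟩ := Finsupp.support_nonempty_iff.mpr hE0
  have hwpos : 0 < E w := lt_of_le_of_ne (hE w) (Ne.symm (Finsupp.mem_support_iff.mp hw))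
  -- `E - w ≥ 0` has degree `1 - deg w ≥ 0`
  set E' := E - Finsupp.single w 1 with hE'
  have hE'0 : 0 ≤ E' := fun v => by
    show (0 : Divisor k V.FunctionField) v ≤ (E - Finsupp.single w 1 : Divisor k V.FunctionField) v
    rw [Finsupp.coe_zero, Pi.zero_apply, Finsupp.sub_apply]
    by_cases hv : v = w
    · subst hv; rw [Finsupp.single_eq_same]; omega
    · rw [Finsupp.single_eq_of_ne hv, sub_zero]; exact hE v
  have hdeg' : E'.degree = 1 - w.degree := by
    rw [hE', map_sub, h1, Divisor.degree_single, one_mul]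
  have h0 : 0 ≤ E'.degree := Divisor.degree_nonneg_of_nonneg hE'0
  have hw1 : 1 ≤ w.degree := PlaceOver.one_le_degree w
  have hwdeg : w.degree = 1 := by omega
  refine ⟨w, hwdeg, ?_⟩
  -- `E' ≥ 0` of degree `0` vanishes
  have hE'z : E' = 0 := by
    by_contra hne
    obtain ⟨u, hu⟩ := Finsupp.support_nonempty_iff.mpr hne
    have hupos : 0 < E' u := lt_of_le_of_ne (hE'0 u) (Ne.symm (Finsupp.mem_support_iff.mp hu))
    have := Divisor.apply_le_degree hE'0 u
    omega
  rw [hE'] at hE'z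
  exact (sub_eq_zero.mp hE'z)

/-- **Stichtenoth Prop. 6.1.6 (a) for `k(V)`, in explicit form**: for every place `v` of degree
`d` there are a nonzero function `x` and a rational point `P ∈ V(k)` with
`(x) = placeOfPoint P - v + (d - 1) · ∞`, i.e. `v ∼ P + (d - 1)∞`. Proof: the divisor
`A = v - (d - 1)∞` has degree `1`, so `ℓ(A) ≥ 1` (`WeierstrassGenus.degree_le_ell`, Riemann–Roch
with `g = 1`); for `0 ≠ x ∈ ℒ(A)` the divisor `(x) + A ≥ 0` has degree `1`, hence is a rational
place, hence the place of a rational point (`exists_placeOfPoint_eq`).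
[cite: Stichtenoth2009, Prop. 6.1.6(a)] -/
theorem exists_principalDivisor_eq (v : PlaceOver k V.FunctionField) :
    ∃ x : V.FunctionField, x ≠ 0 ∧ ∃ P : V.Point,
      principalDivisor k x = Finsupp.single (placeOfPoint V P) 1 - Finsupp.single v 1 +
        ((v.degree : ℤ) - 1) • Finsupp.single (infPlace V) 1 := by
  set A : Divisor k V.FunctionField :=
    Finsupp.single v 1 - ((v.degree : ℤ) - 1) • Finsupp.single (infPlace V) 1 with hA
  have hdegA : A.degree = 1 := by
    rw [hA, map_sub, map_zsmul, Divisor.degree_single, Divisor.degree_single, degree_infPlace]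
    ring
  -- `ℓ(A) ≥ 1`: a nonzero `x ∈ ℒ(A)`
  have hell : (1 : ℤ) ≤ ell A := hdegA ▸ WeierstrassGenus.degree_le_ell V A
  have hne : riemannRochSpace A ≠ ⊥ := by
    intro hbot
    have : ell A = 0 := by rw [ell, hbot, finrank_bot]
    omega
  obtain ⟨x, hxA, hx0⟩ := (Submodule.ne_bot_iff _).mp hne
  -- `E = (x) + A ≥ 0` of degree `1`
  set E := principalDivisor k x + A with hE
  have hE0 : 0 ≤ E := fun w => by
    have h := (mem_riemannRochSpace_iff_neg_le_ord A hx0).mp hxA w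
    rw [hE, Finsupp.add_apply, principalDivisor_apply (finite_setOf_ord_ne_zero_holds hx0)]
    simp only [Finsupp.coe_zero, Pi.zero_apply]
    omega
  have hdegE : E.degree = 1 := by
    rw [hE, map_add, degree_principalDivisor_eq_zero hx0, hdegA, zero_add]
  obtain ⟨w, hw1, hEw⟩ := exists_eq_single_of_degree_eq_one hE0 hdegE
  obtain ⟨P, rfl⟩ := exists_placeOfPoint_eq (V := V) hw1
  refine ⟨x, hx0, P, ?_⟩
  have : principalDivisor k x = E - A := by rw [hE]; abel
  rw [this, hEw, hA]
  abel

/-! ### `toClass` is an isomorphism `V(k) ≅ Cl(k[V])` -/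

/-- The class of every finite place is the class of a rational point. [cite: Stichtenoth2009, Prop. 6.1.6(a)] -/
theorem exists_toClass_eq_finClass_single_ofPrime (𝔭 : HeightOneSpectrum V.CoordinateRing) :
    ∃ P : V.Point, WeierstrassCurve.Affine.Point.toClass P =
      finClass V (Finsupp.single (PlaceOver.ofPrime k V.FunctionField 𝔭) 1) := by
  obtain ⟨x, hx0, P, hx⟩ := exists_principalDivisor_eq (PlaceOver.ofPrime k V.FunctionField 𝔭)
  refine ⟨P, ?_⟩
  have h := finClass_principalDivisor (V := V) x
  rw [hx, map_add, map_sub, map_zsmul, finClass_single_infPlace, smul_zero, add_zero,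
    sub_eq_zero, finClass_single_placeOfPoint] at h
  exact h

variable (V) in
/-- **`toClass` is surjective**: every ideal class of the Dedekind domain `k[V]` is `[𝔪_P]` for a
rational point `P` (`[𝔪_O] := 1`) — the ideal-theoretic form of Stichtenoth Prop. 6.1.6 (b)
(`Cl(k[V]) = Cl(k(V))/⟨[∞]⟩ ≅ Cl⁰(k(V))`). Proof: `Cl(k[V])` is generated by the classes of the
maximal ideals (unique factorisation), each of which is a `toClass P`.
[cite: Stichtenoth2009, Prop. 6.1.6(b)] -/
theorem toClass_surjective :
    Function.Surjective
      (WeierstrassCurve.Affine.Point.toClass : V.Point → Additive (ClassGroup V.CoordinateRing)) := by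
  set H : AddSubgroup (Additive (ClassGroup V.CoordinateRing)) :=
    (WeierstrassCurve.Affine.Point.toClass : V.Point →+ _).range with hH
  suffices htop : ∀ c : Additive (ClassGroup V.CoordinateRing), c ∈ H by
    intro c
    exact htop c
  -- every `mk0 J`, `J` a nonzero ideal, lies in `H`: induction on the factorisation of `J`
  have key : ∀ J : Ideal V.CoordinateRing, ∀ hJ : J ≠ ⊥,
      Additive.ofMul (ClassGroup.mk0 ⟨J, mem_nonZeroDivisors_of_ne_zero hJ⟩) ∈ H := by
    intro J
    induction J using UniqueFactorizationMonoid.induction_on_prime with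
    | h₁ => intro h; exact absurd rfl h
    | h₂ J hJu =>
      intro hJ
      have hJ1 : J = ⊤ := Ideal.isUnit_iff.mp hJu
      subst hJ1
      have : (ClassGroup.mk0 ⟨(⊤ : Ideal V.CoordinateRing), mem_nonZeroDivisors_of_ne_zero hJ⟩) = 1 := by
        rw [ClassGroup.mk0_eq_one_iff]
        exact ⟨1, by simp⟩
      rw [this]
      exact H.zero_mem
    | h₃ J p hJ0 hp ih =>
      intro hpJ
      have hp0 : p ≠ ⊥ := hp.ne_zero
      have hJ0' : J ≠ ⊥ := hJ0
      haveI : p.IsPrime := Ideal.isPrime_of_prime hp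
      let 𝔭 : HeightOneSpectrum V.CoordinateRing := ⟨p, inferInstance, hp0⟩
      have hmul : (ClassGroup.mk0 ⟨p * J, mem_nonZeroDivisors_of_ne_zero hpJ⟩) =
          ClassGroup.mk0 ⟨p, mem_nonZeroDivisors_of_ne_zero hp0⟩ *
            ClassGroup.mk0 ⟨J, mem_nonZeroDivisors_of_ne_zero hJ0'⟩ := by
        rw [← map_mul]
        rfl
      rw [hmul, ofMul_mul]
      refine H.add_mem ?_ (ih hJ0')
      obtain ⟨P, hP⟩ := exists_toClass_eq_finClass_single_ofPrime (V := V) 𝔭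
      rw [finClass_single_ofPrime] at hP
      exact ⟨P, hP⟩
  intro c
  obtain ⟨⟨J, hJ⟩, hc⟩ := ClassGroup.mk0_surjective (Additive.toMul c)
  have hJ0 : J ≠ ⊥ := nonZeroDivisors.ne_zero hJ
  have := key J hJ0
  rwa [show (⟨J, mem_nonZeroDivisors_of_ne_zero hJ0⟩ : (Ideal V.CoordinateRing)⁰) = ⟨J, hJ⟩ from rfl,
    hc] at this

variable (V) in
/-- **`V(k) ≅ Cl(k[V])`** via `P ↦ [𝔪_P]` (Mathlib's injective `toClass`, now bijective).
[cite: Stichtenoth2009, Prop. 6.1.6(b) and Prop. 6.1.7(d)] -/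
def toClassEquiv : V.Point ≃+ Additive (ClassGroup V.CoordinateRing) :=
  AddEquiv.ofBijective (WeierstrassCurve.Affine.Point.toClass : V.Point →+ _)
    ⟨WeierstrassCurve.Affine.Point.toClass_injective, toClass_surjective V⟩

/-- Unfolding of `toClassEquiv`. [folklore] -/
@[simp]
theorem toClassEquiv_apply (P : V.Point) :
    toClassEquiv V P = WeierstrassCurve.Affine.Point.toClass P :=
  rfl

/-! ### The Abel–Jacobi map `Div(k(V)) → V(k)` -/

variable (V) in
/-- **The point of a divisor** (Abel–Jacobi map of `k(V)/k`): the unique homomorphism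
`Div(k(V)) →+ V(k)` with `toClass (pointOfDivisor D) = [finite part of D]`; it sends the place of
a rational point `P` to `P`, `∞` and all principal divisors to `O`, and a place `v` of degree `d`
to the rational point `P` with `v ∼ P + (d - 1)∞` (Stichtenoth (6.13): `Φ⁻¹`, extended from
`Cl⁰` to all divisors by `D ↦ D - (deg D)·∞`). [cite: Stichtenoth2009, (6.13) and Prop. 6.1.7] -/
def pointOfDivisor : Divisor k V.FunctionField →+ V.Point :=
  (toClassEquiv V).symm.toAddMonoidHom.comp (finClass V)

/-- The defining property: `toClass (pointOfDivisor D) = finClass D`. [folklore] -/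
@[simp]
theorem toClass_pointOfDivisor (D : Divisor k V.FunctionField) :
    WeierstrassCurve.Affine.Point.toClass (pointOfDivisor V D) = finClass V D := by
  rw [pointOfDivisor, AddMonoidHom.comp_apply, AddEquiv.coe_toAddMonoidHom, ← toClassEquiv_apply,
    AddEquiv.apply_symm_apply]

/-- `pointOfDivisor D = P ↔ finClass D = toClass P`. [folklore] -/
theorem pointOfDivisor_eq_iff {D : Divisor k V.FunctionField} {P : V.Point} :
    pointOfDivisor V D = P ↔ finClass V D = WeierstrassCurve.Affine.Point.toClass P := by
  rw [← toClass_pointOfDivisor]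
  exact ⟨fun h => h ▸ rfl, fun h => WeierstrassCurve.Affine.Point.toClass_injective h⟩

/-- **`pointOfDivisor (n · placeOfPoint P) = n · P`.** [cite: Stichtenoth2009, Prop. 6.1.7(b)-(c)] -/
@[simp]
theorem pointOfDivisor_single_placeOfPoint (P : V.Point) (n : ℤ) :
    pointOfDivisor V (Finsupp.single (placeOfPoint V P) n) = n • P := by
  rw [pointOfDivisor_eq_iff, finClass_single_placeOfPoint_zsmul, map_zsmul]

/-- **Principal divisors have point `O`** (`⊕ (x) = O`; Stichtenoth Prop. 6.1.7 (c), Silverman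
Cor. III.3.5 "⇒"). [cite: Stichtenoth2009, Prop. 6.1.7(c)] -/
@[simp]
theorem pointOfDivisor_principalDivisor (x : V.FunctionField) :
    pointOfDivisor V (principalDivisor k x) = 0 := by
  rw [pointOfDivisor_eq_iff, finClass_principalDivisor, map_zero]

/-- The place at infinity has point `O`. [folklore] -/
@[simp]
theorem pointOfDivisor_single_infPlace (n : ℤ) :
    pointOfDivisor V (Finsupp.single (infPlace V) n) = 0 := by
  rw [pointOfDivisor_eq_iff, finClass_single_infPlace, map_zero]

/-- The point of a finite place `P_𝔭` is the rational point whose maximal ideal is equivalent to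
`𝔭` in `Cl(k[V])`. [folklore] -/
theorem toClass_pointOfDivisor_single_ofPrime (𝔭 : HeightOneSpectrum V.CoordinateRing) :
    WeierstrassCurve.Affine.Point.toClass
        (pointOfDivisor V (Finsupp.single (PlaceOver.ofPrime k V.FunctionField 𝔭) 1)) =
      Additive.ofMul (ClassGroup.mk0 ⟨𝔭.asIdeal, mem_nonZeroDivisors_of_ne_zero 𝔭.ne_bot⟩) := by
  rw [toClass_pointOfDivisor, finClass_single_ofPrime]

/-- Linearly equivalent divisors have the same point. [folklore] -/
theorem pointOfDivisor_eq_of_isLinearlyEquivalent {D D' : Divisor k V.FunctionField}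
    (h : D.IsLinearlyEquivalent D') : pointOfDivisor V D = pointOfDivisor V D' := by
  obtain ⟨x, -, hx⟩ := h
  have := pointOfDivisor_principalDivisor (V := V) x
  rwa [hx, map_sub, sub_eq_zero] at this

/-! ### Abel–Jacobi over `k`: principal divisors, `Cl⁰(k(V)) ≅ V(k)` (Stichtenoth Prop. 6.1.7) -/

omit [V.IsElliptic] in
/-- A divisor of `k(V)` vanishing at all finite places and of degree `0` is `0`. [folklore] -/
theorem eq_zero_of_forall_ofPrime_eq_zero [IsDedekindDomain V.CoordinateRing]
    {D : Divisor k V.FunctionField}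
    (hfin : ∀ 𝔭 : HeightOneSpectrum V.CoordinateRing, D (PlaceOver.ofPrime k V.FunctionField 𝔭) = 0)
    (hdeg : D.degree = 0) : D = 0 := by
  have hD : D = Finsupp.single (infPlace V) (D (infPlace V)) := by
    ext v
    rcases WeierstrassPlaces.eq_infPlace_or_exists_eq_ofPrime V v with rfl | ⟨𝔭, rfl⟩
    · simp
    · rw [hfin 𝔭, Finsupp.single_eq_of_ne (WeierstrassPlaces.infPlace_ne_ofPrime V 𝔭).symm]
  rw [hD, Divisor.degree_single, degree_infPlace, Nat.cast_one, mul_one] at hdeg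
  rw [hD, hdeg, Finsupp.single_zero]

/-- **Abel–Jacobi for `k(V)`** (Stichtenoth Prop. 6.1.7 (c)–(d); Silverman *AEC* Cor. III.3.5 over
`k̄`): a divisor is principal iff it has degree `0` and its point is `O`. "⇐": `finClass D = 0`
makes the finite part a principal fractional ideal `(x)`, and `(x)`, `D` agree at the finite places
and in degree, hence at `∞`. [cite: Stichtenoth2009, Prop. 6.1.7(c)-(d)] [cite: SilvermanAEC2009, Cor. III.3.5] -/
theorem isPrincipal_iff (D : Divisor k V.FunctionField) :
    D.IsPrincipal ↔ D.degree = 0 ∧ pointOfDivisor V D = 0 := by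
  constructor
  · rintro ⟨x, hx0, rfl⟩
    exact ⟨degree_principalDivisor_eq_zero hx0, pointOfDivisor_principalDivisor x⟩
  · rintro ⟨hdeg, hpt⟩
    have hcl : ClassGroup.mk V.FunctionField (finUnit V D) = 1 := by
      have h := (pointOfDivisor_eq_iff (V := V)).mp hpt
      rw [map_zero, finClass_apply] at h
      exact h
    obtain ⟨x, hx⟩ := (ClassGroup.mk_eq_one_iff.mp hcl)
    -- `finIdeal D = (x)` with `x ≠ 0`
    have hxI : finIdeal V D = spanSingleton V.CoordinateRing⁰ x :=
      FractionalIdeal.coeToSubmodule_injective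
        (show ((finIdeal V D : FractionalIdeal V.CoordinateRing⁰ V.FunctionField) :
            Submodule V.CoordinateRing V.FunctionField) =
          ((spanSingleton V.CoordinateRing⁰ x : FractionalIdeal V.CoordinateRing⁰ V.FunctionField) :
            Submodule V.CoordinateRing V.FunctionField) by
          rw [coe_spanSingleton]; exact hx)
    have hx0 : x ≠ 0 := by
      rintro rfl
      exact finIdeal_ne_zero D (by rw [hxI, spanSingleton_zero])
    refine ⟨x, hx0, ?_⟩
    -- `(x) - D` vanishes at finite places and has degree `0`
    have hz := eq_zero_of_forall_ofPrime_eq_zero (V := V) (D := principalDivisor k x - D)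
      (fun 𝔭 => by
        rw [Finsupp.sub_apply, ← count_finIdeal D 𝔭, hxI, ← ord_ofPrime_eq_count 𝔭 hx0,
          principalDivisor_apply (finite_setOf_ord_ne_zero_holds hx0), sub_self])
      (by rw [map_sub, degree_principalDivisor_eq_zero hx0, hdeg, sub_zero])
    exact sub_eq_zero.mp hz

/-- **Stichtenoth Prop. 6.1.6: a divisor of degree `0` is equivalent to `P - ∞` for the rational
point `P = pointOfDivisor D`** (existence and, by `isPrincipal_iff`, uniqueness of `P`).
[cite: Stichtenoth2009, Prop. 6.1.6(a)-(b)] -/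
theorem isLinearlyEquivalent_single_sub {D : Divisor k V.FunctionField} (hD : D.degree = 0) :
    D.IsLinearlyEquivalent
      (Finsupp.single (placeOfPoint V (pointOfDivisor V D)) 1 - Finsupp.single (infPlace V) 1) := by
  rw [Divisor.IsLinearlyEquivalent, isPrincipal_iff]
  constructor
  · rw [map_sub, map_sub, hD, Divisor.degree_single, Divisor.degree_single, degree_placeOfPoint,
      degree_infPlace]
    simp
  · rw [map_sub, map_sub, pointOfDivisor_single_placeOfPoint, pointOfDivisor_single_infPlace,
      one_smul, sub_zero, sub_self]

/-- Uniqueness in Prop. 6.1.6: if `D ∼ P - ∞` then `P = pointOfDivisor D`. [cite: Stichtenoth2009, Prop. 6.1.6(a)] -/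
theorem eq_pointOfDivisor_of_isLinearlyEquivalent {D : Divisor k V.FunctionField} {P : V.Point}
    (h : D.IsLinearlyEquivalent
      (Finsupp.single (placeOfPoint V P) 1 - Finsupp.single (infPlace V) 1)) :
    P = pointOfDivisor V D := by
  have := pointOfDivisor_eq_of_isLinearlyEquivalent (V := V) h
  rw [map_sub, pointOfDivisor_single_placeOfPoint, pointOfDivisor_single_infPlace, one_smul,
    sub_zero] at this
  exact this.symm

variable (V) in
/-- `pointOfDivisor` on divisor classes: `Cl(k(V)) →+ V(k)` (principal divisors go to `O`).
[cite: Stichtenoth2009, (6.13)] -/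
def pointOfClass : DivisorClass k V.FunctionField →+ V.Point :=
  QuotientAddGroup.lift (principalDivisors k V.FunctionField) (pointOfDivisor V) fun D hD => by
    obtain ⟨x, -, rfl⟩ := mem_principalDivisors_iff.mp hD
    exact pointOfDivisor_principalDivisor x

/-- `pointOfClass [D] = pointOfDivisor D` (definitional). [folklore] -/
@[simp]
theorem pointOfClass_mk (D : Divisor k V.FunctionField) :
    pointOfClass V (DivisorClass.mk D) = pointOfDivisor V D :=
  rfl

variable (V) in
/-- **Stichtenoth Prop. 6.1.7 (d): `Cl⁰(k(V)) ≅ V(k)`**, `[D] ↦ pointOfDivisor D`, with inverse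
`P ↦ [placeOfPoint P - ∞]` (the map `Φ` of (6.13) with `P₀ = ∞`); the group law transported along
`Φ` ((6.14)) is Mathlib's chord–tangent law on `V(k)`. Here `Cl⁰` is the kernel of the tree's
`DivisorClass.degree`. [cite: Stichtenoth2009, Prop. 6.1.7(d)] -/
def degreeZeroClassEquiv :
    (DivisorClass.degree (K := k) (F := V.FunctionField)).ker ≃+ V.Point :=
  AddEquiv.ofBijective ((pointOfClass V).comp (AddSubgroup.subtype _))
    ⟨by
      rintro ⟨c, hc⟩ ⟨c', hc'⟩ h
      induction c using QuotientAddGroup.induction_on with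
      | H D =>
      induction c' using QuotientAddGroup.induction_on with
      | H D' =>
      simp only [AddMonoidHom.coe_comp, AddSubgroup.coe_subtype, Function.comp_apply,
        pointOfClass_mk] at h
      rw [AddMonoidHom.mem_ker, DivisorClass.degree_mk] at hc hc'
      refine Subtype.ext ((DivisorClass.mk_eq_mk_iff).mpr ?_)
      rw [Divisor.IsLinearlyEquivalent, isPrincipal_iff, map_sub, hc, hc', sub_zero, map_sub, h,
        sub_self]
      exact ⟨rfl, rfl⟩,
    fun P => by
      refine ⟨⟨DivisorClass.mk
        (Finsupp.single (placeOfPoint V P) 1 - Finsupp.single (infPlace V) 1), ?_⟩, ?_⟩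
      · rw [AddMonoidHom.mem_ker, DivisorClass.degree_mk, map_sub, Divisor.degree_single,
          Divisor.degree_single, degree_placeOfPoint, degree_infPlace]
        simp
      · simp⟩

/-- Unfolding of `degreeZeroClassEquiv`. [folklore] -/
@[simp]
theorem degreeZeroClassEquiv_apply_mk (D : Divisor k V.FunctionField)
    (hD : DivisorClass.mk D ∈ (DivisorClass.degree (K := k) (F := V.FunctionField)).ker) :
    degreeZeroClassEquiv V ⟨DivisorClass.mk D, hD⟩ = pointOfDivisor V D :=
  rfl

/-! ### Characters of `V(k)` as unramified characters of the divisor group -/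

section Characters

variable {M : Type*} [CommMonoid M]

variable (V) in
/-- **A character `ω` of the group of rational points as a character of the divisor group**,
`D ↦ ω(pointOfDivisor D)`: an unramified character (trivial on ALL principal divisors) whose
value at the place of a rational point `P` is `ω(P)` — the character `ω ∈ Hom(E(k), ℂ*)` of
[KohelShparlinski2000, §2] read on divisors. [cite: KohelShparlinski2000, §2 and Thm. 1 ("ω determines an unramified character")] -/
def divisorChar (ω : AddChar V.Point M) : AddChar (Divisor k V.FunctionField) M :=
  ω.compAddMonoidHom (pointOfDivisor V)

/-- Unfolding of `divisorChar`. [folklore] -/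
@[simp]
theorem divisorChar_apply (ω : AddChar V.Point M) (D : Divisor k V.FunctionField) :
    divisorChar V ω D = ω (pointOfDivisor V D) :=
  rfl

/-- `divisorChar ω` is unramified: it kills every principal divisor. [cite: KohelShparlinski2000, Thm. 1] -/
theorem divisorChar_principalDivisor (ω : AddChar V.Point M) (x : V.FunctionField) :
    divisorChar V ω (principalDivisor k x) = 1 := by
  rw [divisorChar_apply, pointOfDivisor_principalDivisor, AddChar.map_zero_eq_one]

/-- The value at the place of a rational point: `divisorChar ω (placeOfPoint P) = ω P`.
[cite: KohelShparlinski2000, §2] -/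
theorem divisorChar_single_placeOfPoint (ω : AddChar V.Point M) (P : V.Point) :
    divisorChar V ω (Finsupp.single (placeOfPoint V P) 1) = ω P := by
  rw [divisorChar_apply, pointOfDivisor_single_placeOfPoint, one_smul]

/-- The value at (a multiple of) the place at infinity is `1`. [folklore] -/
theorem divisorChar_single_infPlace (ω : AddChar V.Point M) (n : ℤ) :
    divisorChar V ω (Finsupp.single (infPlace V) n) = 1 := by
  rw [divisorChar_apply, pointOfDivisor_single_infPlace, AddChar.map_zero_eq_one]

/-- Linearly equivalent divisors have the same character values. [folklore] -/
theorem divisorChar_eq_of_isLinearlyEquivalent (ω : AddChar V.Point M)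
    {D D' : Divisor k V.FunctionField} (h : D.IsLinearlyEquivalent D') :
    divisorChar V ω D = divisorChar V ω D' := by
  rw [divisorChar_apply, divisorChar_apply, pointOfDivisor_eq_of_isLinearlyEquivalent h]

/-- The trivial character of `V(k)` gives the trivial character of `Div(k(V))`. [folklore] -/
@[simp]
theorem divisorChar_one : divisorChar V (1 : AddChar V.Point M) = 1 := by
  ext D
  rfl

/-- `divisorChar` is multiplicative in `ω`. [folklore] -/
theorem divisorChar_mul (ω ω' : AddChar V.Point M) :
    divisorChar V (ω * ω') = divisorChar V ω * divisorChar V ω' := by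
  ext D
  rfl

end Characters

/-! ### Uniqueness of the Abel–Jacobi map (appended) -/

/-- **`pointOfDivisor` is the unique homomorphism `Div(k(V)) →+ V(k)` sending the place of every
rational point `P` to `P` and every principal divisor to `O`.** Indeed every place `v` of degree `d`
satisfies `v ∼ P + (d - 1)∞` for a rational point `P` (`exists_principalDivisor_eq`), so such a
homomorphism is determined on all places. (This identifies `pointOfDivisor` with any other
normalisation of the Abel–Jacobi map, e.g. the sum of the Frobenius orbit of a geometric point above
`v`.) [cite: Stichtenoth2009, Prop. 6.1.6(a) and Prop. 6.1.7(d)] -/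
theorem eq_pointOfDivisor {Φ : Divisor k V.FunctionField →+ V.Point}
    (hpt : ∀ P : V.Point, Φ (Finsupp.single (placeOfPoint V P) 1) = P)
    (hprinc : ∀ x : V.FunctionField, x ≠ 0 → Φ (principalDivisor k x) = 0) :
    Φ = pointOfDivisor V := by
  refine Finsupp.addHom_ext fun v n => ?_
  -- reduce to `n = 1` through `single v n = n • single v 1`
  have hsingle : (Finsupp.single v n : Divisor k V.FunctionField) = n • Finsupp.single v 1 := by
    rw [Finsupp.smul_single, smul_eq_mul, mul_one]
  rw [hsingle, map_zsmul, map_zsmul]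
  congr 1
  obtain ⟨x, hx0, P, hx⟩ := exists_principalDivisor_eq (V := V) v
  have hv : (Finsupp.single v 1 : Divisor k V.FunctionField) =
      Finsupp.single (placeOfPoint V P) 1 + ((v.degree : ℤ) - 1) • Finsupp.single (infPlace V) 1 -
        principalDivisor k x := by
    rw [hx]; abel
  have hinfΦ : Φ (Finsupp.single (infPlace V) 1) = 0 := by
    rw [← placeOfPoint_zero (V := V)]; exact hpt 0
  rw [hv, map_sub, map_add, map_zsmul, hpt P, hinfΦ, smul_zero, add_zero, hprinc x hx0, sub_zero,
    map_sub, map_add, map_zsmul, pointOfDivisor_single_placeOfPoint, one_smul,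
    pointOfDivisor_single_infPlace, smul_zero, add_zero, pointOfDivisor_principalDivisor, sub_zero]

/-- Pointwise form of `eq_pointOfDivisor`. [cite: Stichtenoth2009, Prop. 6.1.7(d)] -/
theorem apply_eq_pointOfDivisor {Φ : Divisor k V.FunctionField →+ V.Point}
    (hpt : ∀ P : V.Point, Φ (Finsupp.single (placeOfPoint V P) 1) = P)
    (hprinc : ∀ x : V.FunctionField, x ≠ 0 → Φ (principalDivisor k x) = 0)
    (D : Divisor k V.FunctionField) : Φ D = pointOfDivisor V D := by
  rw [eq_pointOfDivisor hpt hprinc]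

end Literature.NumberTheory.EllipticCurves.WeierstrassDivisorClassPoints
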